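import Summits.QuantumFields.BalabanUV.Beta.GAN24.SigmaPairSlotMomentsExit
import Summits.QuantumFields.BalabanUV.Beta.GAN24.WardGammaExitExplicitPotential
import Summits.QuantumFields.BalabanUV.Beta.GAN24.GaugeReadSourcePairingSucc

/-!
# `BalabanUV.Beta.GAN24.SlotMomentExitPairOfSourcePairing` — binder row G-an2-4 ∕ (CONV-C), the (S) row «(S) := (INV-X-geo) ∘ (W-γ)» (RULING R-gan24p1-g27-1 B (viii),
# R-g28-1 (i)), EXIT⊗EXIT class, LEVELS `j + 1 ≥ 1`: **THE JUNCTION OF THE THREE HANDS.  The (S) row at level `j+1` — (M0) ∧ (Π) for the σ-pair's exit⊗exit charge profile —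
# holds MODULO ONE DISPLAYED IDENTITY about ONE EXPLICIT 1-form: the source pairing of `n⋆ := n_{c·Π^ρ m̃^{Lc}_{αβ}}` (the charge tower's explicit potential) against
# `gaugeWt ⊗ 𝒟_{j+1}(e)` equals `−½(stepScale_{j+1}·Lc^{d+1})·Σ'_u Σ_κ 𝟙[blk(u+e_κ) = y]·colH G_{j+1}(e) κ u·C_{j+1}(κ,u)` — stated (§1) in road-P2's pairing form and (§2) in
# leaf-06 g48's REDUCED form `(cE·wE_{j+1})·X_{j+1}(n⋆, 1_{B(y)}; e) − Λ-share(n⋆)`**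
# (G-an2-4 CRUX TEAM (2), seat `b2b-balaban-gan24-p2` = road-P2 chair, gen 43, INTENT 4 v2 part 2; v1 `SlotMomentExitPair` withdrawn in favour of leaf-02 g59's FILE B)

NOT IN PRINT; OUR BOOKKEEPING ([folklore] composition BY NAME: leaf-02 g59 FILE B `SigmaPairSlotMomentsExit.moments_sigmaPair_exit_of_ward_level` (the (S) row at every level `k`
modulo (W-γ)_k alone; their probe J2′ `ProbeJ2prime.moments_succ_of_sourcePairing`, CLAIMS l.47929, is §1's composition with a generic potential — adopted with thanks), leaf-06 g48
FILE B″ `GaugeReadSourcePairingSucc.gaugeLeg_sourcePairing_dM_succ` (their junction probe X2-J1, CLAIMS l.48131, is §2's rewriting step), leaf-06 g47 FILE C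
`GaugeReadExitPairing.abs_sourceForm_le ∕ sourceForm_eq_zero_of_isCombBond ∕ contourSum_sourceForm_eq_zero`, this seat's `WardGammaExitExplicitPotential` (part 1) and
`RotatedVertexEndExitValue.tsum_prod_exit_M1At`; 0 `def`, 0 cited fact, 0 `def … : Prop`, 0 sorry).
HONEST FRAMING (cell contract, verbatim): «discharging `BetaPertH` makes Bałaban's UV stability UNCONDITIONAL — a real constructive-QFT result; it is NOT the continuum limit and NOT
the Clay problem.»  HONEST DEPENDENCY (verbatim): «continuum YM on T⁴ ⇐ BetaPertH ∧ nine spine estimates (0/9 proved); BetaPertH ⇐ (D1) ∧ (D4) ∧ CAP+tail; G-an2-4 gates asym,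
D1 and NE2/3/4.»

THE OBJECTS.  CENTRED root `ρ = toSite (ctrOff (d+1) Lc)`, `Lc` odd (leaf-02's (INV-X-geo)); `G_k = coDressKBmAt ρ Lc (KInvStep Lc k)`, `S_k`, `M_k`, `𝒟_k(e)` as in part 1; the exit⊗exit charge
`C_{j+1}`; the explicit potential `m⋆_c = c·Π^ρ m̃` and its source form `n⋆`; leaf-02 FILE B's profiles at `k = j+1`: `Vα` (base-point profile of (α)), `Vend` (end-point), `Qc` (leaf-06's (γ)
profile of `G_{j+1} ∘ 𝒟_{j+1}(ν,y′)`), bound by their defining equations `hVα ∕ hVend ∕ hQc` (instantiate with `fun _ => rfl`); `Z := Vα − ½(stepScale_{j+1}·Lc^{d+1})⁻¹·Qc`.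
* §1 **`moments_sigmaPair_exit_succ_of_explicitSourcePairing`** — THE (S) ROW AT LEVEL `j+1` (centred root, `Lc` odd, `α ≠ β`, every `j ν y`; all `cE cVH cΛ` in the signature, but the
  displayed identity is EXPECTED ONLY AT THE TOWER's PIN `cE = Lc^{d+1}` — leaf-06 g48 ENGINE E29: `c′ = −(cE∕2)·stepScale_{j+1}`, Λ-share `0` there): IF for every slot `y′`
  and every `c` with `C_{j+1} = wVH_{j+1}·Δ_{j+1} m⋆_c` the `n⋆ ⊗ gaugeWt` pairing of `𝒟_{j+1}(ν,y′)` is `−½(stepScale_{j+1}·Lc^{d+1})·Σ'_u Σ_κ 𝟙[blk(u+e_κ) = y]·colH G_{j+1}(ν,y′) κ u·C_{j+1}(κ,u)`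
  THEN `Σ' Z = 0 ∧ ∀ λ, Σ' (y′−y)_λ·Z(y′) = 0` (part 1 §3 ⨾ `tsum_prod_exit_M1At` — the multiplier halves of `Qc` and `Vend` vanish ⨾ leaf-02 FILE B §3).
* §2 **`moments_sigmaPair_exit_succ_of_reducedPairing`** — THE SAME WITH THE HYPOTHESIS IN leaf-06 g48's REDUCED FORM: «`(cE·wE_{j+1})·X_{j+1}(n⋆, 1_{B(y)}; ν, y′) −
  (cΛ·wM1_{j+1})(2Lc^{d+1})⁻¹·Σ'_w Σ_κ 𝒬_{Lc}(σ_{1_{B(y)}}⊙n⋆) κ w·colM G_{j+1}(ν,y′) κ w = −½(stepScale_{j+1}·Lc^{d+1})·(R_end-sum)`» (§1 ⨾ `gaugeLeg_sourcePairing_dM_succ`, FILE C's side conditions).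
WHAT REMAINS DISPLAYED for the (S) row of the exit⊗exit class at levels `≥ 1` is therefore ONE identity between `G_j`, `G_{j+1}`, `SrecAt j` and ONE explicit comb-free contour-free
periodic 1-form: the closed form of `X_{j+1}(n⋆, 1_{B(y)}; e)` (leaf-06 g48 ENGINE E29: `−(cE∕2)·stepScale_{j+1}` at the pins; mechanism (C1)∕(C2)) — NOT a theorem here.  Asserts NO value
of any resolvent column; (W-γ) at levels `≥ 1` ∕ (S) ∕ (INV) ∕ (Π) NOT claimed unconditionally; NOTHING of (Q-R) ∕ (DL) ∕ (LT) ∕ «T2Shape» ∕ (hW, hWall) discharged; NEVER «G-an2-4 closed»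
as (CONV-C); NOT D1, NOT `BetaPertH`, NOT continuum, NOT Clay.  2026-08-23; no existing file touched.
-/

noncomputable section

open Finset
open scoped BigOperators
open Literature.MathematicalPhysics.QuantumFieldTheory
open Literature.MathematicalPhysics.QuantumFieldTheory.Balaban1983to89
open Literature.MathematicalPhysics.QuantumFieldTheory.Balaban1983to89.Beta
open ExpKernelCalculus (Site MKer comp)
open AffineAveraging (Form1 box toSite unitVec dz contourSum)
open AveragingContours (blk)
open AveragingContoursRooted (ctrOff ctrOff_mem_box)
open RootedComb (axProjAt)
open KernelSpecInstance (wΦ)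
open OneStepResolventKernel (Fib)
open OneStepKernelFamily (KInvStep colH)
open SecondOrderResponse (colM dM)
open BalabanStepW2 (wM1)
open BalabanStepJetsSucc (wE wVH)
open Summit.QuantumFields.BalabanUV.Beta.BorderedHessian (stepScale)
open Summit.QuantumFields.BalabanUV.Beta.AxialDressingRooted (coDressKBmAt)
open Summit.QuantumFields.BalabanUV.Beta.SpineRooted (SpureRecAt M1At e3OfK)
open Summit.QuantumFields.BalabanUV.Beta.WardLocusRecursive (SrecAt)
open Summit.QuantumFields.BalabanUV.Beta.KernelWardRelative (gaugeWt)
open Summit.QuantumFields.BalabanUV.Beta.GAN24.CombSlotDerivativeBorderRead (gaugeWt_eq_dz)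
open Summit.QuantumFields.BalabanUV.Beta.GAN24.GaugeReadExitPairing (sourceForm_eq_zero_of_isCombBond abs_sourceForm_le contourSum_sourceForm_eq_zero)
open Summit.QuantumFields.BalabanUV.Beta.GAN24.RotatedVertexEndExitValue (tsum_prod_exit_M1At)
open Summit.QuantumFields.BalabanUV.Beta.GAN24.WardGammaExitExplicitPotential (explicitPotential_abs_le explicitPotential_add_zsmul wardGamma_exit_of_explicitSourcePairing)
open Summit.QuantumFields.BalabanUV.Beta.GAN24.GaugeReadSourcePairingSucc (gaugeLeg_sourcePairing_dM_succ)
open Summit.QuantumFields.BalabanUV.Beta.GAN24.SigmaPairSlotMomentsExit (moments_sigmaPair_exit_of_ward_level)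

namespace Summit.QuantumFields.BalabanUV.Beta.GAN24.SlotMomentExitPairOfSourcePairing

variable {d : ℕ} {Lc : ℕ} [NeZero Lc]

/-! ## §1 The (S) row at level `j+1` modulo the explicit source pairing -/

/-- NOT IN PRINT; OUR BOOKKEEPING.  **THE (S) ROW FOR THE EXIT⊗EXIT σ-PAIR AT LEVEL `j+1`, MODULO THE SOURCE PAIRING OF `n⋆` ALONE** (centred root, `Lc` odd, `α ≠ β`, all `cE cVH cΛ`,
every `j y ν`; the profiles `Vα ∕ Vend ∕ Qc` bound by their defining equations — instantiate with `fun _ => rfl`): IF for every slot `y′` and every real `c` with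
`C_{j+1} = wVH_{j+1}·Δ_{j+1}(c·Π^ρ m̃)` the `n⋆ ⊗ gaugeWt` source pairing of `𝒟_{j+1}(ν,y′)` equals `−½(stepScale_{j+1}·Lc^{d+1})·Σ'_u Σ_κ 𝟙[blk(u+e_κ) = y]·colH G_{j+1}(ν,y′) κ u·C_{j+1}(κ,u)`
THEN `Σ'_{y′} Z(y′) = 0 ∧ ∀ λ, Σ'_{y′} (y′−y)_λ·Z(y′) = 0`, `Z = Vα − ½(stepScale_{j+1}·Lc^{d+1})⁻¹·Qc` — (M0) ∧ (Π) for the σ-pair one level up.  The constant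
`−½(stepScale_{j+1}·Lc^{d+1})` is forced by FILE B's `hW` shape; by leaf-06 g48's ENGINE E29 (`c′ = −(cE∕2)·stepScale_{j+1}`) the hypothesis is the expected identity exactly AT THE PIN
`cE = Lc^{d+1}` of the residual tower (off the pin it is not expected to hold and the theorem is idle) (part 1 §3 ⨾ `tsum_prod_exit_M1At` (the multiplier
halves of `Qc` and `Vend` vanish) ⨾ leaf-02 g59 `moments_sigmaPair_exit_of_ward_level`; their probe J2′ with the hypothesis restricted to the explicit potential). -/
theorem moments_sigmaPair_exit_succ_of_explicitSourcePairing (hLc : Odd Lc) (cE cVH cΛ : ℝ) (j : ℕ) (y : Site (d + 1)) (ν : Fin (d + 1)) {α β : Fin (d + 1)} (hαβ : α ≠ β)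
    {Vα Vend Qc : Site (d + 1) → ℝ}
    (hVα : ∀ y' : Site (d + 1), Vα y' = ((1 / 2 : ℝ) *
        ((∑ κ : Fin (d + 1), ∑' u : Site (d + 1),
            colH (coDressKBmAt (toSite (ctrOff (d + 1) Lc)) Lc (KInvStep (d := d) Lc (j + 1))) Lc ν y' κ u
              * ((if y' = y then (1 / 2 : ℝ) else 0) - (if blk Lc u = y then (1 / 2 : ℝ) else 0))
              * ∑' xz : Site (d + 1) × Site (d + 1), ((if xz.1 α % (Lc : ℤ) = (Lc : ℤ) - 1 then (1 : ℝ) else 0) * (if xz.2 β % (Lc : ℤ) = (Lc : ℤ) - 1 then (1 : ℝ) else 0))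
            * SpureRecAt d Lc (toSite (ctrOff (d + 1) Lc)) cE cVH cΛ (j + 1) κ u xz.1 xz.2 (Sum.inl α) (Sum.inl β))
          + ∑ ρ' : Fin (d + 1), ∑' w : Site (d + 1),
            colM (coDressKBmAt (toSite (ctrOff (d + 1) Lc)) Lc (KInvStep (d := d) Lc (j + 1))) Lc ν y' ρ' w
              * ((if y' = y then (1 / 2 : ℝ) else 0) - (if w = y then (1 / 2 : ℝ) else 0))
              * ∑' xz : Site (d + 1) × Site (d + 1), ((if xz.1 α % (Lc : ℤ) = (Lc : ℤ) - 1 then (1 : ℝ) else 0) * (if xz.2 β % (Lc : ℤ) = (Lc : ℤ) - 1 then (1 : ℝ) else 0))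
            * M1At d Lc (toSite (ctrOff (d + 1) Lc)) cΛ (j + 1) ρ' w xz.1 xz.2 (Sum.inl α) (Sum.inl β))))
    (hVend : ∀ y' : Site (d + 1), Vend y' = ((1 / 2 : ℝ) *
        ((∑ κ : Fin (d + 1), ∑' u : Site (d + 1),
            colH (coDressKBmAt (toSite (ctrOff (d + 1) Lc)) Lc (KInvStep (d := d) Lc (j + 1))) Lc ν y' κ u
              * ((if y' + Pi.single ν 1 = y then (1 / 2 : ℝ) else 0) - (if blk Lc (u + Pi.single κ 1) = y then (1 / 2 : ℝ) else 0))
              * ∑' xz : Site (d + 1) × Site (d + 1), ((if xz.1 α % (Lc : ℤ) = (Lc : ℤ) - 1 then (1 : ℝ) else 0) * (if xz.2 β % (Lc : ℤ) = (Lc : ℤ) - 1 then (1 : ℝ) else 0))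
            * SpureRecAt d Lc (toSite (ctrOff (d + 1) Lc)) cE cVH cΛ (j + 1) κ u xz.1 xz.2 (Sum.inl α) (Sum.inl β))
          + ∑ ρ' : Fin (d + 1), ∑' w : Site (d + 1),
            colM (coDressKBmAt (toSite (ctrOff (d + 1) Lc)) Lc (KInvStep (d := d) Lc (j + 1))) Lc ν y' ρ' w
              * ((if y' + Pi.single ν 1 = y then (1 / 2 : ℝ) else 0) - (if w + Pi.single ρ' 1 = y then (1 / 2 : ℝ) else 0))
              * ∑' xz : Site (d + 1) × Site (d + 1), ((if xz.1 α % (Lc : ℤ) = (Lc : ℤ) - 1 then (1 : ℝ) else 0) * (if xz.2 β % (Lc : ℤ) = (Lc : ℤ) - 1 then (1 : ℝ) else 0))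
            * M1At d Lc (toSite (ctrOff (d + 1) Lc)) cΛ (j + 1) ρ' w xz.1 xz.2 (Sum.inl α) (Sum.inl β))))
    (hQc : ∀ y' : Site (d + 1), Qc y' = (∑ κ : Fin (d + 1), ∑' u : Site (d + 1),
        (∑' x₂, ∑ κ₂, comp (coDressKBmAt (toSite (ctrOff (d + 1) Lc)) Lc (KInvStep (d := d) Lc (j + 1)))
            (dM (coDressKBmAt (toSite (ctrOff (d + 1) Lc)) Lc (KInvStep (d := d) Lc (j + 1))) Lc (SpureRecAt d Lc (toSite (ctrOff (d + 1) Lc)) cE cVH cΛ (j + 1)) (M1At d Lc (toSite (ctrOff (d + 1) Lc)) cΛ (j + 1)) ν y')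
            u x₂ (Sum.inl κ) (Sum.inl κ₂) * gaugeWt Lc y κ₂ x₂)
          * ∑' xz : Site (d + 1) × Site (d + 1), ((if xz.1 α % (Lc : ℤ) = (Lc : ℤ) - 1 then (1 : ℝ) else 0) * (if xz.2 β % (Lc : ℤ) = (Lc : ℤ) - 1 then (1 : ℝ) else 0))
            * SpureRecAt d Lc (toSite (ctrOff (d + 1) Lc)) cE cVH cΛ (j + 1) κ u xz.1 xz.2 (Sum.inl α) (Sum.inl β)
      + ∑ ρ' : Fin (d + 1), ∑' w : Site (d + 1),
        (∑' x₂, ∑ κ₂, comp (coDressKBmAt (toSite (ctrOff (d + 1) Lc)) Lc (KInvStep (d := d) Lc (j + 1)))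
            (dM (coDressKBmAt (toSite (ctrOff (d + 1) Lc)) Lc (KInvStep (d := d) Lc (j + 1))) Lc (SpureRecAt d Lc (toSite (ctrOff (d + 1) Lc)) cE cVH cΛ (j + 1)) (M1At d Lc (toSite (ctrOff (d + 1) Lc)) cΛ (j + 1)) ν y')
            ((Lc : ℤ) • w) x₂ (Sum.inr ρ') (Sum.inl κ₂) * gaugeWt Lc y κ₂ x₂)
          * ∑' xz : Site (d + 1) × Site (d + 1), ((if xz.1 α % (Lc : ℤ) = (Lc : ℤ) - 1 then (1 : ℝ) else 0) * (if xz.2 β % (Lc : ℤ) = (Lc : ℤ) - 1 then (1 : ℝ) else 0))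
            * M1At d Lc (toSite (ctrOff (d + 1) Lc)) cΛ (j + 1) ρ' w xz.1 xz.2 (Sum.inl α) (Sum.inl β)))
    (hP : ∀ (y' : Site (d + 1)) (c : ℝ), (∀ (ν : Fin (d + 1)) (y' : Site (d + 1)), ∑' xz : Site (d + 1) × Site (d + 1),
        (if xz.1 α % (Lc : ℤ) = (Lc : ℤ) - 1 then (1 : ℝ) else 0) * (if xz.2 β % (Lc : ℤ) = (Lc : ℤ) - 1 then (1 : ℝ) else 0)
          * SpureRecAt d Lc (toSite (ctrOff (d + 1) Lc)) cE cVH cΛ (j + 1) ν y' xz.1 xz.2 (Sum.inl α) (Sum.inl β)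
        = wVH d Lc (j + 1) * ∑' v, ∑ l : Fin (d + 1), wΦ (N := Lc ^ (j + 1)) ν l (y' - v) * (c * axProjAt (toSite (ctrOff (d + 1) Lc)) Lc
            (fun l x => (if l = α then ((Lc : ℝ) ^ 2)⁻¹ * (((x β % (Lc : ℤ) : ℤ)) : ℝ) else 0)
              - (if l = β then (Lc : ℝ)⁻¹ * (if x β % (Lc : ℤ) = (Lc : ℤ) - 1 then (1 : ℝ) else 0) * (((x α % (Lc : ℤ) : ℤ)) : ℝ) else 0)) l v)) →
      ∑' x, ∑ κ₂, gaugeWt Lc y κ₂ x * (∑' u, ∑ κ,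
          (axProjAt (toSite (ctrOff (d + 1) Lc)) Lc
                  (fun l v => c * axProjAt (toSite (ctrOff (d + 1) Lc)) Lc
                (fun l x => (if l = α then ((Lc : ℝ) ^ 2)⁻¹ * (((x β % (Lc : ℤ) : ℤ)) : ℝ) else 0)
              - (if l = β then (Lc : ℝ)⁻¹ * (if x β % (Lc : ℤ) = (Lc : ℤ) - 1 then (1 : ℝ) else 0) * (((x α % (Lc : ℤ) : ℤ)) : ℝ) else 0)) l v) κ u
                - ((Lc : ℝ) ^ (d + 1))⁻¹ * (contourSum Lc
                  (fun l v => c * axProjAt (toSite (ctrOff (d + 1) Lc)) Lc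
                (fun l x => (if l = α then ((Lc : ℝ) ^ 2)⁻¹ * (((x β % (Lc : ℤ) : ℤ)) : ℝ) else 0)
              - (if l = β then (Lc : ℝ)⁻¹ * (if x β % (Lc : ℤ) = (Lc : ℤ) - 1 then (1 : ℝ) else 0) * (((x α % (Lc : ℤ) : ℤ)) : ℝ) else 0)) l v) κ 0
                  * (if u κ % (Lc : ℤ) = (Lc : ℤ) - 1 then (1 : ℝ) else 0)))
            * dM (coDressKBmAt (toSite (ctrOff (d + 1) Lc)) Lc (KInvStep (d := d) Lc (j + 1))) Lc (SpureRecAt d Lc (toSite (ctrOff (d + 1) Lc)) cE cVH cΛ (j + 1)) (M1At d Lc (toSite (ctrOff (d + 1) Lc)) cΛ (j + 1)) ν y'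
                u x (Sum.inl κ) (Sum.inl κ₂))
        = (-(stepScale d Lc (j + 1) * (Lc : ℝ) ^ (d + 1)) / 2) * ∑' u : Site (d + 1), ∑ κ : Fin (d + 1), (if blk Lc (u + Pi.single κ 1) = y then (1 : ℝ) else 0)
            * colH (coDressKBmAt (toSite (ctrOff (d + 1) Lc)) Lc (KInvStep (d := d) Lc (j + 1))) Lc ν y' κ u
            * ∑' xz : Site (d + 1) × Site (d + 1), ((if xz.1 α % (Lc : ℤ) = (Lc : ℤ) - 1 then (1 : ℝ) else 0) * (if xz.2 β % (Lc : ℤ) = (Lc : ℤ) - 1 then (1 : ℝ) else 0))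
            * SpureRecAt d Lc (toSite (ctrOff (d + 1) Lc)) cE cVH cΛ (j + 1) κ u xz.1 xz.2 (Sum.inl α) (Sum.inl β)) :
    (∑' y' : Site (d + 1), (Vα y' - (1 / 2 : ℝ) * (stepScale d Lc (j + 1) * (Lc : ℝ) ^ (d + 1))⁻¹ * Qc y') = 0)
      ∧ ∀ lam : Fin (d + 1),
        ∑' y' : Site (d + 1), (((y' - y) lam : ℤ) : ℝ) * (Vα y' - (1 / 2 : ℝ) * (stepScale d Lc (j + 1) * (Lc : ℝ) ^ (d + 1))⁻¹ * Qc y') = 0 := by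
  have hr := ctrOff_mem_box (d := d + 1) hLc.pos
  refine moments_sigmaPair_exit_of_ward_level hLc cE cVH cΛ (j + 1) y ν α β hVα hVend hQc fun y' => ?_
  have hW := wardGamma_exit_of_explicitSourcePairing hr cE cVH cΛ hαβ j ν y' y _ (hP y')
  rw [hQc, hVend]
  simp only [tsum_prod_exit_M1At hr cΛ (j + 1) α β, mul_zero, tsum_zero, Finset.sum_const_zero, add_zero]
  rw [hW]
  simp only [tsum_prod_exit_M1At hr cΛ (j + 1) α β, mul_zero, tsum_zero, Finset.sum_const_zero, add_zero]
  ring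

/-! ## §2 The same with leaf-06 g48's reduced pairing -/

/-- NOT IN PRINT; OUR BOOKKEEPING.  **THE (S) ROW AT LEVEL `j+1` MODULO leaf-06 g48's REDUCED PAIRING OF `n⋆`** (centred root, `Lc` odd, `α ≠ β`, all `cE cVH cΛ`, every `j y ν`): the hypothesis
of §1 with its left side REWRITTEN by `GaugeReadSourcePairingSucc.gaugeLeg_sourcePairing_dM_succ` — «for every slot `y′` and every `c` with the charge identity,
`(cE·wE_{j+1})·X_{j+1}(n⋆, 1_{B(y)}; ν, y′) − (cΛ·wM1_{j+1})(2Lc^{d+1})⁻¹·Σ'_w Σ_κ 𝒬_{Lc}(σ_{1_{B(y)}}⊙n⋆) κ w·colM G_{j+1}(ν,y′) κ w = −½(stepScale_{j+1}·Lc^{d+1})·(R_end-sum)`»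
⟹ (M0) ∧ (Π) for the σ-pair one level up.  THE ONE THING LEFT DISPLAYED for the (S) row of the exit⊗exit class at levels `≥ 1` is thus the closed form of `X_{j+1}` on ONE explicit
comb-free contour-free periodic 1-form (FILE C's `abs_sourceForm_le ∕ sourceForm_eq_zero_of_isCombBond ∕ contourSum_sourceForm_eq_zero` supply B″'s side conditions). -/
theorem moments_sigmaPair_exit_succ_of_reducedPairing (hLc : Odd Lc) (cE cVH cΛ : ℝ) (j : ℕ) (y : Site (d + 1)) (ν : Fin (d + 1)) {α β : Fin (d + 1)} (hαβ : α ≠ β)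
    {Vα Vend Qc : Site (d + 1) → ℝ}
    (hVα : ∀ y' : Site (d + 1), Vα y' = ((1 / 2 : ℝ) *
        ((∑ κ : Fin (d + 1), ∑' u : Site (d + 1),
            colH (coDressKBmAt (toSite (ctrOff (d + 1) Lc)) Lc (KInvStep (d := d) Lc (j + 1))) Lc ν y' κ u
              * ((if y' = y then (1 / 2 : ℝ) else 0) - (if blk Lc u = y then (1 / 2 : ℝ) else 0))
              * ∑' xz : Site (d + 1) × Site (d + 1), ((if xz.1 α % (Lc : ℤ) = (Lc : ℤ) - 1 then (1 : ℝ) else 0) * (if xz.2 β % (Lc : ℤ) = (Lc : ℤ) - 1 then (1 : ℝ) else 0))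
            * SpureRecAt d Lc (toSite (ctrOff (d + 1) Lc)) cE cVH cΛ (j + 1) κ u xz.1 xz.2 (Sum.inl α) (Sum.inl β))
          + ∑ ρ' : Fin (d + 1), ∑' w : Site (d + 1),
            colM (coDressKBmAt (toSite (ctrOff (d + 1) Lc)) Lc (KInvStep (d := d) Lc (j + 1))) Lc ν y' ρ' w
              * ((if y' = y then (1 / 2 : ℝ) else 0) - (if w = y then (1 / 2 : ℝ) else 0))
              * ∑' xz : Site (d + 1) × Site (d + 1), ((if xz.1 α % (Lc : ℤ) = (Lc : ℤ) - 1 then (1 : ℝ) else 0) * (if xz.2 β % (Lc : ℤ) = (Lc : ℤ) - 1 then (1 : ℝ) else 0))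
            * M1At d Lc (toSite (ctrOff (d + 1) Lc)) cΛ (j + 1) ρ' w xz.1 xz.2 (Sum.inl α) (Sum.inl β))))
    (hVend : ∀ y' : Site (d + 1), Vend y' = ((1 / 2 : ℝ) *
        ((∑ κ : Fin (d + 1), ∑' u : Site (d + 1),
            colH (coDressKBmAt (toSite (ctrOff (d + 1) Lc)) Lc (KInvStep (d := d) Lc (j + 1))) Lc ν y' κ u
              * ((if y' + Pi.single ν 1 = y then (1 / 2 : ℝ) else 0) - (if blk Lc (u + Pi.single κ 1) = y then (1 / 2 : ℝ) else 0))
              * ∑' xz : Site (d + 1) × Site (d + 1), ((if xz.1 α % (Lc : ℤ) = (Lc : ℤ) - 1 then (1 : ℝ) else 0) * (if xz.2 β % (Lc : ℤ) = (Lc : ℤ) - 1 then (1 : ℝ) else 0))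
            * SpureRecAt d Lc (toSite (ctrOff (d + 1) Lc)) cE cVH cΛ (j + 1) κ u xz.1 xz.2 (Sum.inl α) (Sum.inl β))
          + ∑ ρ' : Fin (d + 1), ∑' w : Site (d + 1),
            colM (coDressKBmAt (toSite (ctrOff (d + 1) Lc)) Lc (KInvStep (d := d) Lc (j + 1))) Lc ν y' ρ' w
              * ((if y' + Pi.single ν 1 = y then (1 / 2 : ℝ) else 0) - (if w + Pi.single ρ' 1 = y then (1 / 2 : ℝ) else 0))
              * ∑' xz : Site (d + 1) × Site (d + 1), ((if xz.1 α % (Lc : ℤ) = (Lc : ℤ) - 1 then (1 : ℝ) else 0) * (if xz.2 β % (Lc : ℤ) = (Lc : ℤ) - 1 then (1 : ℝ) else 0))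
            * M1At d Lc (toSite (ctrOff (d + 1) Lc)) cΛ (j + 1) ρ' w xz.1 xz.2 (Sum.inl α) (Sum.inl β))))
    (hQc : ∀ y' : Site (d + 1), Qc y' = (∑ κ : Fin (d + 1), ∑' u : Site (d + 1),
        (∑' x₂, ∑ κ₂, comp (coDressKBmAt (toSite (ctrOff (d + 1) Lc)) Lc (KInvStep (d := d) Lc (j + 1)))
            (dM (coDressKBmAt (toSite (ctrOff (d + 1) Lc)) Lc (KInvStep (d := d) Lc (j + 1))) Lc (SpureRecAt d Lc (toSite (ctrOff (d + 1) Lc)) cE cVH cΛ (j + 1)) (M1At d Lc (toSite (ctrOff (d + 1) Lc)) cΛ (j + 1)) ν y')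
            u x₂ (Sum.inl κ) (Sum.inl κ₂) * gaugeWt Lc y κ₂ x₂)
          * ∑' xz : Site (d + 1) × Site (d + 1), ((if xz.1 α % (Lc : ℤ) = (Lc : ℤ) - 1 then (1 : ℝ) else 0) * (if xz.2 β % (Lc : ℤ) = (Lc : ℤ) - 1 then (1 : ℝ) else 0))
            * SpureRecAt d Lc (toSite (ctrOff (d + 1) Lc)) cE cVH cΛ (j + 1) κ u xz.1 xz.2 (Sum.inl α) (Sum.inl β)
      + ∑ ρ' : Fin (d + 1), ∑' w : Site (d + 1),
        (∑' x₂, ∑ κ₂, comp (coDressKBmAt (toSite (ctrOff (d + 1) Lc)) Lc (KInvStep (d := d) Lc (j + 1)))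
            (dM (coDressKBmAt (toSite (ctrOff (d + 1) Lc)) Lc (KInvStep (d := d) Lc (j + 1))) Lc (SpureRecAt d Lc (toSite (ctrOff (d + 1) Lc)) cE cVH cΛ (j + 1)) (M1At d Lc (toSite (ctrOff (d + 1) Lc)) cΛ (j + 1)) ν y')
            ((Lc : ℤ) • w) x₂ (Sum.inr ρ') (Sum.inl κ₂) * gaugeWt Lc y κ₂ x₂)
          * ∑' xz : Site (d + 1) × Site (d + 1), ((if xz.1 α % (Lc : ℤ) = (Lc : ℤ) - 1 then (1 : ℝ) else 0) * (if xz.2 β % (Lc : ℤ) = (Lc : ℤ) - 1 then (1 : ℝ) else 0))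
            * M1At d Lc (toSite (ctrOff (d + 1) Lc)) cΛ (j + 1) ρ' w xz.1 xz.2 (Sum.inl α) (Sum.inl β)))
    (hX : ∀ (y' : Site (d + 1)) (c : ℝ), (∀ (ν : Fin (d + 1)) (y' : Site (d + 1)), ∑' xz : Site (d + 1) × Site (d + 1),
        (if xz.1 α % (Lc : ℤ) = (Lc : ℤ) - 1 then (1 : ℝ) else 0) * (if xz.2 β % (Lc : ℤ) = (Lc : ℤ) - 1 then (1 : ℝ) else 0)
          * SpureRecAt d Lc (toSite (ctrOff (d + 1) Lc)) cE cVH cΛ (j + 1) ν y' xz.1 xz.2 (Sum.inl α) (Sum.inl β)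
        = wVH d Lc (j + 1) * ∑' v, ∑ l : Fin (d + 1), wΦ (N := Lc ^ (j + 1)) ν l (y' - v) * (c * axProjAt (toSite (ctrOff (d + 1) Lc)) Lc
            (fun l x => (if l = α then ((Lc : ℝ) ^ 2)⁻¹ * (((x β % (Lc : ℤ) : ℤ)) : ℝ) else 0)
              - (if l = β then (Lc : ℝ)⁻¹ * (if x β % (Lc : ℤ) = (Lc : ℤ) - 1 then (1 : ℝ) else 0) * (((x α % (Lc : ℤ) : ℤ)) : ℝ) else 0)) l v)) →
      (cE * wE d Lc (j + 1)) * (∑ l, ∑' t, colH (coDressKBmAt (toSite (ctrOff (d + 1) Lc)) Lc (KInvStep (d := d) Lc (j + 1))) Lc ν y' l t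
          * ∑' ux : Site (d + 1) × Site (d + 1), ∑ κ, ∑ κ₂,
              (axProjAt (toSite (ctrOff (d + 1) Lc)) Lc
                  (fun l v => c * axProjAt (toSite (ctrOff (d + 1) Lc)) Lc
                (fun l x => (if l = α then ((Lc : ℝ) ^ 2)⁻¹ * (((x β % (Lc : ℤ) : ℤ)) : ℝ) else 0)
              - (if l = β then (Lc : ℝ)⁻¹ * (if x β % (Lc : ℤ) = (Lc : ℤ) - 1 then (1 : ℝ) else 0) * (((x α % (Lc : ℤ) : ℤ)) : ℝ) else 0)) l v) κ ux.1
                - ((Lc : ℝ) ^ (d + 1))⁻¹ * (contourSum Lc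
                  (fun l v => c * axProjAt (toSite (ctrOff (d + 1) Lc)) Lc
                (fun l x => (if l = α then ((Lc : ℝ) ^ 2)⁻¹ * (((x β % (Lc : ℤ) : ℤ)) : ℝ) else 0)
              - (if l = β then (Lc : ℝ)⁻¹ * (if x β % (Lc : ℤ) = (Lc : ℤ) - 1 then (1 : ℝ) else 0) * (((x α % (Lc : ℤ) : ℤ)) : ℝ) else 0)) l v) κ 0
                  * (if ux.1 κ % (Lc : ℤ) = (Lc : ℤ) - 1 then (1 : ℝ) else 0)))
              * dz (fun z : Site (d + 1) => if blk Lc z = y then (1 : ℝ) else 0) κ₂ ux.2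
              * e3OfK Lc (coDressKBmAt (toSite (ctrOff (d + 1) Lc)) Lc (KInvStep (d := d) Lc j)) (SrecAt d Lc (toSite (ctrOff (d + 1) Lc)) cE cVH cΛ j) l t ux.1 ux.2 (Sum.inl κ) (Sum.inl κ₂))
        - (cΛ * wM1 d Lc (j + 1)) * (2 * (Lc : ℝ) ^ (d + 1))⁻¹
          * ∑' w, ∑ κ, contourSum Lc (fun κ u => ((if blk Lc u = y then (1 : ℝ) else 0) + (if blk Lc (u + unitVec κ) = y then (1 : ℝ) else 0))
              * (axProjAt (toSite (ctrOff (d + 1) Lc)) Lc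
                  (fun l v => c * axProjAt (toSite (ctrOff (d + 1) Lc)) Lc
                (fun l x => (if l = α then ((Lc : ℝ) ^ 2)⁻¹ * (((x β % (Lc : ℤ) : ℤ)) : ℝ) else 0)
              - (if l = β then (Lc : ℝ)⁻¹ * (if x β % (Lc : ℤ) = (Lc : ℤ) - 1 then (1 : ℝ) else 0) * (((x α % (Lc : ℤ) : ℤ)) : ℝ) else 0)) l v) κ u
                - ((Lc : ℝ) ^ (d + 1))⁻¹ * (contourSum Lc
                  (fun l v => c * axProjAt (toSite (ctrOff (d + 1) Lc)) Lc
                (fun l x => (if l = α then ((Lc : ℝ) ^ 2)⁻¹ * (((x β % (Lc : ℤ) : ℤ)) : ℝ) else 0)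
              - (if l = β then (Lc : ℝ)⁻¹ * (if x β % (Lc : ℤ) = (Lc : ℤ) - 1 then (1 : ℝ) else 0) * (((x α % (Lc : ℤ) : ℤ)) : ℝ) else 0)) l v) κ 0
                  * (if u κ % (Lc : ℤ) = (Lc : ℤ) - 1 then (1 : ℝ) else 0)))) κ w
            * colM (coDressKBmAt (toSite (ctrOff (d + 1) Lc)) Lc (KInvStep (d := d) Lc (j + 1))) Lc ν y' κ w
        = (-(stepScale d Lc (j + 1) * (Lc : ℝ) ^ (d + 1)) / 2) * ∑' u : Site (d + 1), ∑ κ : Fin (d + 1), (if blk Lc (u + Pi.single κ 1) = y then (1 : ℝ) else 0)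
            * colH (coDressKBmAt (toSite (ctrOff (d + 1) Lc)) Lc (KInvStep (d := d) Lc (j + 1))) Lc ν y' κ u
            * ∑' xz : Site (d + 1) × Site (d + 1), ((if xz.1 α % (Lc : ℤ) = (Lc : ℤ) - 1 then (1 : ℝ) else 0) * (if xz.2 β % (Lc : ℤ) = (Lc : ℤ) - 1 then (1 : ℝ) else 0))
            * SpureRecAt d Lc (toSite (ctrOff (d + 1) Lc)) cE cVH cΛ (j + 1) κ u xz.1 xz.2 (Sum.inl α) (Sum.inl β)) :
    (∑' y' : Site (d + 1), (Vα y' - (1 / 2 : ℝ) * (stepScale d Lc (j + 1) * (Lc : ℝ) ^ (d + 1))⁻¹ * Qc y') = 0)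
      ∧ ∀ lam : Fin (d + 1),
        ∑' y' : Site (d + 1), (((y' - y) lam : ℤ) : ℝ) * (Vα y' - (1 / 2 : ℝ) * (stepScale d Lc (j + 1) * (Lc : ℝ) ^ (d + 1))⁻¹ * Qc y') = 0 := by
  have hLc1 : 1 ≤ Lc := hLc.pos
  have hr := ctrOff_mem_box (d := d + 1) hLc1
  refine moments_sigmaPair_exit_succ_of_explicitSourcePairing hLc cE cVH cΛ j y ν hαβ hVα hVend hQc fun y' c hT => ?_
  rw [← hX y' c hT]
  simp only [gaugeWt_eq_dz]
  exact gaugeLeg_sourcePairing_dM_succ hr cE cVH cΛ j ν y'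
    (n := fun κ u => (axProjAt (toSite (ctrOff (d + 1) Lc)) Lc
                  (fun l v => c * axProjAt (toSite (ctrOff (d + 1) Lc)) Lc
                (fun l x => (if l = α then ((Lc : ℝ) ^ 2)⁻¹ * (((x β % (Lc : ℤ) : ℤ)) : ℝ) else 0)
              - (if l = β then (Lc : ℝ)⁻¹ * (if x β % (Lc : ℤ) = (Lc : ℤ) - 1 then (1 : ℝ) else 0) * (((x α % (Lc : ℤ) : ℤ)) : ℝ) else 0)) l v) κ u
                - ((Lc : ℝ) ^ (d + 1))⁻¹ * (contourSum Lc
                  (fun l v => c * axProjAt (toSite (ctrOff (d + 1) Lc)) Lc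
                (fun l x => (if l = α then ((Lc : ℝ) ^ 2)⁻¹ * (((x β % (Lc : ℤ) : ℤ)) : ℝ) else 0)
              - (if l = β then (Lc : ℝ)⁻¹ * (if x β % (Lc : ℤ) = (Lc : ℤ) - 1 then (1 : ℝ) else 0) * (((x α % (Lc : ℤ) : ℤ)) : ℝ) else 0)) l v) κ 0
                  * (if u κ % (Lc : ℤ) = (Lc : ℤ) - 1 then (1 : ℝ) else 0))))
    (abs_sourceForm_le hLc1 hr (fun κ u => explicitPotential_abs_le hr hαβ c κ u) (((Lc : ℝ) ^ (d + 1))⁻¹)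
      (fun κ => contourSum Lc
        (fun l v => c * axProjAt (toSite (ctrOff (d + 1) Lc)) Lc
                (fun l x => (if l = α then ((Lc : ℝ) ^ 2)⁻¹ * (((x β % (Lc : ℤ) : ℤ)) : ℝ) else 0)
              - (if l = β then (Lc : ℝ)⁻¹ * (if x β % (Lc : ℤ) = (Lc : ℤ) - 1 then (1 : ℝ) else 0) * (((x α % (Lc : ℤ) : ℤ)) : ℝ) else 0)) l v) κ 0))
    (fun κ u h => sourceForm_eq_zero_of_isCombBond hLc1 (toSite (ctrOff (d + 1) Lc))
        (fun l v => c * axProjAt (toSite (ctrOff (d + 1) Lc)) Lc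
                (fun l x => (if l = α then ((Lc : ℝ) ^ 2)⁻¹ * (((x β % (Lc : ℤ) : ℤ)) : ℝ) else 0)
              - (if l = β then (Lc : ℝ)⁻¹ * (if x β % (Lc : ℤ) = (Lc : ℤ) - 1 then (1 : ℝ) else 0) * (((x α % (Lc : ℤ) : ℤ)) : ℝ) else 0)) l v) (((Lc : ℝ) ^ (d + 1))⁻¹)
        (fun κ => contourSum Lc
          (fun l v => c * axProjAt (toSite (ctrOff (d + 1) Lc)) Lc
                (fun l x => (if l = α then ((Lc : ℝ) ^ 2)⁻¹ * (((x β % (Lc : ℤ) : ℤ)) : ℝ) else 0)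
              - (if l = β then (Lc : ℝ)⁻¹ * (if x β % (Lc : ℤ) = (Lc : ℤ) - 1 then (1 : ℝ) else 0) * (((x α % (Lc : ℤ) : ℤ)) : ℝ) else 0)) l v) κ 0) h)
    (contourSum_sourceForm_eq_zero (ctrOff (d + 1) Lc) (fun κ x v => explicitPotential_add_zsmul hαβ c κ x v))
    (ψ := fun z : Site (d + 1) => if blk Lc z = y then (1 : ℝ) else 0) (Bψ := 1) (fun u => by split_ifs <;> simp)

end Summit.QuantumFields.BalabanUV.Beta.GAN24.SlotMomentExitPairOfSourcePairing

end
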